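import Literature.NumberTheory.Automorphic.BaseChangeStrongCuspidalPrime
import Literature.NumberTheory.Automorphic.BaseChangeCyclicCuspidalProofs
import Literature.NumberTheory.Automorphic.BaseChangeStrongUnramifiedRankOne
import Literature.NumberTheory.Automorphic.BaseChangeStrongUnramifiedUnitaryReduction
import Literature.NumberTheory.Automorphic.ArthurClozelDvdOfTwistEqHolds
import Literature.NumberTheory.Automorphic.Sweep1BaseChangeGLOneAssembly
import Literature.NumberTheory.Automorphic.StrongMultiplicityOneGLOne
import Literature.NumberTheory.Automorphic.AutomorphicGaloisConjProofs
import HarnessLib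

/-!
# Strong cuspidal base change in prime degree `ℓ` for `GL_n`, `ℓ ∤ n`, from the tree's leaves;
# the cases `n = 0` and `n = 1` of `ArthurClozel1989_strongLifting_cuspidal`, unconditionally

Topic `NumberTheory/Automorphic`; proof file (theorems only: no definition, no named fact, no
instance), sibling of `BaseChangeStrongCuspidalPrime`, whose named fact
`ArthurClozel1989_strongLifting_cuspidal` (Arthur–Clozel, Ann. of Math. Stud. 120 (1989), Ch. 3,
Thm. 4.2 (a) with Thm. 5.1: for `E/F` Galois of prime degree and `π` cuspidal on `GL_n(𝔸_F)`
unramified at some place ramified in `E`, a CUSPIDAL `P` on `GL_n(𝔸_E)` with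
`t_{P,w} = t_{π,v}^{f(w|v)}` at every finite `w ∣ v`, `v` unramified in `E`) is XL (twisted trace
formula).  Here:

* `ArthurClozel1989_strongLifting_cuspidal.of_not_dvd_of_leaves` — **for `ℓ = [E:F] ∤ n` the
  conclusion of the fact holds for EVERY cuspidal `π`** (no hypothesis at a ramified place), granted,
  in rank `n` only, the three standard leaves of the tree: Thm. 4.2 (a) in `L²`
  (`ArthurClozel1989_weakLifting_cuspidal n`), its hypothesis `multiplicity_one_gl n`, and clause (i)
  of Thm. 5.1 at the unramified places (`ArthurClozel1989_strongLifting_unramified`, rank `n`).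
  Printed proof, p. 203: for `ℓ ∤ n` one has `π ≇ π ⊗ η` automatically, by Thm. 4.2 (b) — in the
  tree the discharged `ArthurClozel1989_dvd_of_twist_eq_holds` (`π ⊗ η = π ⇒ ℓ ∣ n`); the passage
  from the Borel–Jacquet datum `π` to `L²_cusp` and back is that of
  `baseChange_cyclic_cuspidal_of_weakLifting` (`BaseChangeCyclicCuspidalProofs` §5, repeated here
  with the non-twist step replaced), and the weak lift is upgraded to an unramified strong lift by
  Thm. 5.1 (i).
* `ArthurClozel1989_strongLifting_cuspidal.rank_one` — **the case `n = 1` of the named fact,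
  unconditionally** (all three leaves are theorems in rank one:
  `arthurClozel1989_weakLifting_cuspidal_one`, `multiplicity_one_gl_one`,
  `ArthurClozel1989_strongLifting_unramified.rank_one`; and `ℓ ∤ 1`).
* `ArthurClozel1989_strongLifting_cuspidal.rank_zero` — the degenerate edge `n = 0`
  (`GL_0`: every datum is unramified everywhere with the empty parameter).
* `ArthurClozel1989_strongLifting_cuspidal.of_leaves_of_not_dvd` — the named fact itself, restricted
  to the pairs `ℓ ∤ n`, from the all-`n` leaves `hX`, `hm1` and `ArthurClozel1989_strongLifting_unramified`.

## References

* J. Arthur, L. Clozel, *Simple algebras, base change, and the advanced theory of the trace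
  formula*, Ann. of Math. Stud. 120 (1989), Ch. 3: §1 (1.1), Def. 1.1–1.2, Thm. 4.2 (a), (b) and
  proof (p. 203), Thm. 5.1. [ArthurClozelAMS120]
* A. Borel, H. Jacquet, *Automorphic forms and automorphic representations*, Corvallis 1979, §4.6
  and 5.7. [BorelJacquetCorvallis1979]
-/

noncomputable section

open scoped MatrixGroups NNReal Classical
open NumberField IsDedekindDomain MeasureTheory Filter

namespace Literature.NumberTheory.Automorphic

open AdelicGroupData
open Literature.NumberTheory.GaloisRepresentations (HeckeCharacter)

namespace ArthurClozel1989_strongLifting_cuspidal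

/-- **Arthur–Clozel's strong cuspidal base change in prime degree `ℓ ∤ n`, from the rank-`n`
leaves.**  Granting, for `GL_n` over all number fields, Thm. 4.2 (a) in `L²` (`hX`), multiplicity
one on `L²_cusp(GL_n)` (`hm1`) and clause (i) of Thm. 5.1 at the unramified places (`h51`): for
`E/F` Galois of prime degree `ℓ` NOT dividing `n` and EVERY cuspidal `π` on `GL_n(𝔸_F)` there is a
cuspidal `P` on `GL_n(𝔸_E)` with `t_{P,w} = t_{π,v}^{f(w|v)}` at every finite `w ∣ v` over a place
`v` unramified in `E` at which `π` has a Satake parameter.  Proof: `n ≥ 1`; take the automorphic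
measure `μ` and the class-field character `η` (`exists_isClassFieldCharacter_holds`); realise a
clean model of `π` twisted into `P ≤ L²_cusp` with `t_π = q^{s} t_P` at every place
(`exists_hasSatakeParameterAt_cpow_mul_of_clean`); `P ⊗ η ≠ P` since otherwise `ℓ ∣ n`
(Thm. 4.2 (b), `ArthurClozel1989_dvd_of_twist_eq_holds`); Thm. 4.2 (a) gives a cuspidal weak lift
`Q` over `E`, realised by a cuspidal datum `ρ` almost everywhere
(`exists_cuspidalRepData_hasSatakeParamAt`), and `Π = ρ ⊗ |det|_E^{s}` is a weak lift of `π`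
(verbatim the computation of `baseChange_cyclic_cuspidal_of_weakLifting`); finally Thm. 5.1 (i)
makes it an unramified strong lift.
[cite: ArthurClozelAMS120, Ch. 3 Thm. 4.2 (a), (b) (proof p. 203), Thm. 5.1, §1 (1.1)] -/
theorem of_not_dvd_of_leaves {n : ℕ}
    (hX : ∀ (F E : Type) [Field F] [NumberField F] [Field E] [NumberField E] [Algebra F E],
      ArthurClozel1989_weakLifting_cuspidal n F E)
    (hm1 : ∀ (K : Type) [Field K] [NumberField K] (μ : Measure (gl n K).automorphicQuotient)
      [(gl n K).IsAutomorphicMeasure μ], multiplicity_one_gl n K μ)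
    (h51 : ∀ (F E : Type) [Field F] [NumberField F] [Field E] [NumberField E] [Algebra F E]
      [IsGalois F E], (Module.finrank F E).Prime →
      ∀ (hF : isCompact_glFiniteIntegralLevel n F) (hE : isCompact_glFiniteIntegralLevel n E)
        (π : CuspidalAutomorphicRepData n F hF) (P : CuspidalAutomorphicRepData n E hE),
        IsWeakBaseChangeLiftAE π.1 P.1 → IsUnramifiedBaseChangeLift π.1 P.1)
    (F E : Type) [Field F] [NumberField F] [Field E] [NumberField E] [Algebra F E] [IsGalois F E]
    (hℓ : (Module.finrank F E).Prime) (hndvd : ¬ Module.finrank F E ∣ n)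
    (hF : isCompact_glFiniteIntegralLevel n F) (π : CuspidalAutomorphicRepData n F hF)
    (hE : isCompact_glFiniteIntegralLevel n E) :
    ∃ P : CuspidalAutomorphicRepData n E hE, IsUnramifiedBaseChangeLift π.1 P.1 := by
  -- it suffices to produce a cuspidal WEAK lift: Thm. 5.1 (i) upgrades it
  suffices hweak : ∃ P : CuspidalAutomorphicRepData n E hE, IsWeakBaseChangeLiftAE π.1 P.1 by
    obtain ⟨P, hP⟩ := hweak
    exact ⟨P, h51 F E hℓ hF hE π P hP⟩
  classical
  have hn : 0 < n := Nat.pos_of_ne_zero fun h0 => hndvd (h0 ▸ dvd_zero _)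
  haveI : NeZero n := ⟨hn.ne'⟩
  haveI : FiniteDimensional F E := Module.finite_of_finrank_pos hℓ.pos
  haveI : Fact (Module.finrank F E).Prime := ⟨hℓ⟩
  haveI : IsCyclic (E ≃ₐ[F] E) := isCyclic_of_prime_card (IsGalois.card_aut_eq_finrank F E)
  -- the automorphic measure over `F` and the class-field character `η`
  obtain ⟨μ, hμA⟩ := AdelicGroupData.exists_isAutomorphicMeasure_gl_holds n F
  haveI := hμA
  obtain ⟨η, hη, -⟩ := exists_isClassFieldCharacter_holds (F := F) (E := E)
  -- clean model with the same Satake parameters, and its `L²` normalisation `P`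
  obtain ⟨π₀, h0W', h0π⟩ := π.exists_clean_hasSatakeParamAt_iff_of_sSup_irreducible
    AutomorphicRepsGL.stable_cuspidal_eq_sSup_irreducible_holds
  obtain ⟨s, P, hpt⟩ := CuspidalAutomorphicRepData.exists_hasSatakeParameterAt_cpow_mul_of_clean
    (μ := μ) π π₀ h0W' fun v β h => (h0π v β).2 h
  -- `P ⊗ η ≠ P`: otherwise `ℓ ∣ n` (Thm. 4.2 (b), discharged)
  have hPη : P.twistByFiniteOrderChar η hη.isFiniteOrder ≠ P := fun heq =>
    hndvd (ArthurClozel1989_dvd_of_twist_eq_holds (F := F) (E := E) (n := n) hn hℓ η hη μ P heq)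
  -- Thm. 4.2 (a) in `L²`: a cuspidal weak lift `Q` over `E`
  obtain ⟨ν, hνA, hνG, Q, hlift, -, -⟩ := hX F E hn hℓ η hη μ (hm1 F μ) P hPη
  haveI := hνA
  -- `E` side: a cuspidal datum `ρ` with the Satake parameters of `Q` a.e., and `Π = ρ ⊗ |det|_E^{s}`
  obtain ⟨ρ, -, hρ⟩ := Q.exists_cuspidalRepData_hasSatakeParamAt hE
  obtain ⟨S, αP, -, hαP⟩ := exists_isSatakeFamilyOf_holds (n := n) (K := F) (μ := μ) P
  obtain ⟨S₁, AQ, -, hAQ⟩ := exists_isSatakeFamilyOf_holds (n := n) (K := E) (μ := ν) Q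
  obtain ⟨χ, hχ⟩ := exists_heckeCharacter_ideleNorm_cpow E (-s)
  obtain ⟨PE, hPEW, hPEW'⟩ := exists_cuspidalAutomorphicRepData_map_mulChar_detTwist hχ ρ
  refine ⟨PE, ?_⟩
  -- relation (1.1) between the families `αP` of `P` and `AQ` of `Q`, almost everywhere
  have hrel := hlift.eventually_map_pow_eq hαP hAQ
  have hS' : ∀ᶠ w : HeightOneSpectrum (𝓞 E) in cofinite,
      w.under (𝓞 F) ∉ (S : Set (HeightOneSpectrum (𝓞 F))) :=
    (tendsto_under_cofinite (𝓞 F)).eventually S.eventually_cofinite_notMem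
  have hS₁' : ∀ᶠ w : HeightOneSpectrum (𝓞 E) in cofinite, w ∉ (S₁ : Set _) :=
    S₁.eventually_cofinite_notMem
  filter_upwards [hrel, hS', hS₁', hρ] with w hw hwS hwS₁ hρw v' β hv' hβ
  have hv'' : w.under (𝓞 F) = v' := HeightOneSpectrum.ext hv'
  subst hv''
  -- `β = q_v^{s} αP(v)`: `q_v^{-s} β` and `αP v` are two `L²` Satake parameters of `P` at `v`
  have hβ' : β = (αP (w.under (𝓞 F))).map ((((w.under (𝓞 F)).residueCard : ℂ) ^ s) * ·) := by
    obtain ⟨𝔫, ϖ, h𝔫, hv𝔫, hSat⟩ := hpt _ β hβ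
    obtain ⟨𝔫', h𝔫', hv𝔫', ϖ', hϖ'⟩ := hαP _ hwS
    have heq := HasSatakeParameterAt.eq_of_ofLocal_eq_smul
      Flath1979_heckeOperatorAt_ofLocal_eq_smul_holds P h𝔫' h𝔫 hv𝔫' hv𝔫 hϖ' hSat
    rw [heq, Multiset.map_map]
    have hid : ((fun x : ℂ => ((w.under (𝓞 F)).residueCard : ℂ) ^ s * x) ∘
        fun x => ((w.under (𝓞 F)).residueCard : ℂ) ^ (-s) * x) = id :=
      funext fun a => residueCard_cpow_mul_cpow_neg_mul _ s a
    rw [hid, Multiset.map_id]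
  -- `t_{ρ,w} = AQ(w)` and `t_{Π,w} = q_w^{s} AQ(w) = q_w^{s} (αP v)^{f}`
  have hρw' : ρ.1.HasSatakeParamAt w (AQ w) := by
    obtain ⟨𝔫, h𝔫, hw𝔫, ϖ, hSat⟩ := hAQ _ hwS₁
    exact hρw 𝔫 ϖ (AQ w) h𝔫 hw𝔫 hSat
  have hPEw : PE.1.HasSatakeParamAt w ((AQ w).map (((w.residueCard : ℂ) ^ (-(-s))) * ·)) :=
    AutomorphicRepData.HasSatakeParamAt.of_map_mulChar_detTwist_of_cpow hχ hPEW hPEW' hρw'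
  rw [neg_neg, hw hwS hwS₁, Multiset.map_map] at hPEw
  rw [hβ', Multiset.map_map]
  have hfun : ((fun a : ℂ => a ^ w.asIdeal.inertiaDeg (𝓞 F)) ∘
      fun x : ℂ => ((w.under (𝓞 F)).residueCard : ℂ) ^ s * x) =
      ((fun x : ℂ => (w.residueCard : ℂ) ^ s * x) ∘ fun a : ℂ => a ^ w.asIdeal.inertiaDeg (𝓞 F)) := by
    funext a
    simp only [Function.comp_apply]
    rw [mul_pow, residueCard_cpow_eq_residueCard_under_cpow_pow (F := F) w s]
  rw [hfun]
  exact hPEw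

/-- **The named fact `ArthurClozel1989_strongLifting_cuspidal` on the pairs `ℓ ∤ n`, from the
all-`n` leaves of the tree**: Thm. 4.2 (a) in `L²` (`hX`), `multiplicity_one_gl` (`hm1`) and the
named fact `ArthurClozel1989_strongLifting_unramified` (Thm. 5.1 at the unramified places).  The
hypothesis "unramified at a place ramified in `E`" of the fact is not needed when `ℓ ∤ n`.
[cite: ArthurClozelAMS120, Ch. 3 Thm. 4.2 (a), (b), Thm. 5.1] -/
theorem of_leaves_of_not_dvd
    (hX : ∀ (n : ℕ) (F E : Type) [Field F] [NumberField F] [Field E] [NumberField E] [Algebra F E],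
      ArthurClozel1989_weakLifting_cuspidal n F E)
    (hm1 : ∀ (n : ℕ) (K : Type) [Field K] [NumberField K] (μ : Measure (gl n K).automorphicQuotient)
      [(gl n K).IsAutomorphicMeasure μ], multiplicity_one_gl n K μ)
    (h51 : ArthurClozel1989_strongLifting_unramified)
    (n : ℕ) (F E : Type) [Field F] [NumberField F] [Field E] [NumberField E] [Algebra F E]
    [IsGalois F E] (hℓ : (Module.finrank F E).Prime) (hndvd : ¬ Module.finrank F E ∣ n)
    (hF : isCompact_glFiniteIntegralLevel n F) (π : CuspidalAutomorphicRepData n F hF)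
    (hE : isCompact_glFiniteIntegralLevel n E) :
    ∃ P : CuspidalAutomorphicRepData n E hE, IsUnramifiedBaseChangeLift π.1 P.1 :=
  of_not_dvd_of_leaves (hX n) (hm1 n)
    (fun F E _ _ _ _ _ _ hl hF hE π P h => (h51 n F E hl hF hE π P h).1) F E hℓ hndvd hF π hE

/-- **Strong cuspidal base change in prime degree for `GL_1`, unconditionally** — the case `n = 1`
of the named fact `ArthurClozel1989_strongLifting_cuspidal` (indeed without its hypothesis at a
ramified place): the three leaves are theorems of the tree in rank one
(`arthurClozel1989_weakLifting_cuspidal_one`: `χ ↦ χ ∘ N_{E/F}` and strong multiplicity one;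
`multiplicity_one_gl_one`; `ArthurClozel1989_strongLifting_unramified.rank_one`: rigidity of Hecke
characters and the norm on local units over an unramified place), and `ℓ ∤ 1`.
[cite: ArthurClozelAMS120, Ch. 3 Thm. 4.2 (a), Thm. 5.1, for n = 1] -/
theorem rank_one (F E : Type) [Field F] [NumberField F] [Field E] [NumberField E] [Algebra F E]
    [IsGalois F E] (hℓ : (Module.finrank F E).Prime)
    (hF : isCompact_glFiniteIntegralLevel 1 F) (π : CuspidalAutomorphicRepData 1 F hF)
    (hE : isCompact_glFiniteIntegralLevel 1 E) :
    ∃ P : CuspidalAutomorphicRepData 1 E hE, IsUnramifiedBaseChangeLift π.1 P.1 :=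
  of_not_dvd_of_leaves (n := 1)
    (fun _ _ _ _ _ _ _ => arthurClozel1989_weakLifting_cuspidal_one)
    (fun K _ _ μ _ => multiplicity_one_gl_one K μ)
    (fun F E _ _ _ _ _ _ hl hF hE π P h =>
      (ArthurClozel1989_strongLifting_unramified.rank_one F E hl hF hE π P h).1)
    F E hℓ (fun h => hℓ.ne_one (Nat.dvd_one.1 h)) hF π hE

/-- **The degenerate edge `n = 0`**: on `GL_0` cuspidal data exist over `E`
(`nonempty_cuspidalAutomorphicRepGL_zero` realised by `exists_cuspidalRepData_of_L2_holds`) and every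
datum is an unramified strong lift of every other (`ArthurClozel1989_strongLifting_unramified.rank_zero`:
all Satake parameters are empty). [cite: ArthurClozelAMS120, Ch. 3 Thm. 5.1 with §1 (1.1)] -/
theorem rank_zero (F E : Type) [Field F] [NumberField F] [Field E] [NumberField E] [Algebra F E]
    (hF : isCompact_glFiniteIntegralLevel 0 F) (π : CuspidalAutomorphicRepData 0 F hF)
    (hE : isCompact_glFiniteIntegralLevel 0 E) :
    ∃ P : CuspidalAutomorphicRepData 0 E hE, IsUnramifiedBaseChangeLift π.1 P.1 := by
  obtain ⟨ν, hνA⟩ := AdelicGroupData.exists_isAutomorphicMeasure_gl_holds 0 E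
  haveI := hνA
  obtain ⟨Q⟩ := nonempty_cuspidalAutomorphicRepGL_zero E ν
  obtain ⟨P, -, -⟩ := AutomorphicRepsGL.exists_cuspidalRepData_of_L2_holds hE ν Q
  exact ⟨P, (ArthurClozel1989_strongLifting_unramified.rank_zero F E hF hE π P).1⟩

/-- **The named fact's conclusion at `n ≤ 1`, unconditionally, in its own binder shape** (the
hypothesis at a ramified place is accepted and discarded). [cite: ArthurClozelAMS120, Ch. 3 Thm. 4.2 (a), Thm. 5.1] -/
theorem of_le_one {n : ℕ} (hn : n ≤ 1)
    (F E : Type) [Field F] [NumberField F] [Field E] [NumberField E] [Algebra F E]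
    [IsGalois F E] (hℓ : (Module.finrank F E).Prime)
    (hF : isCompact_glFiniteIntegralLevel n F) (π : CuspidalAutomorphicRepData n F hF)
    (_hv : ∃ v : HeightOneSpectrum (𝓞 F),
      ¬ Algebra.IsUnramifiedIn (𝓞 E) v.asIdeal ∧ π.1.IsUnramifiedAt v)
    (hE : isCompact_glFiniteIntegralLevel n E) :
    ∃ P : CuspidalAutomorphicRepData n E hE, IsUnramifiedBaseChangeLift π.1 P.1 := by
  interval_cases n
  · exact rank_zero F E hF π hE
  · exact rank_one F E hℓ hF π hE

end ArthurClozel1989_strongLifting_cuspidal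

end Literature.NumberTheory.Automorphic
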